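import Summits.Langlands.Langlands.Theorems.SqrtFiveQuarticCoversCertH12B7

/-!
# Route `Langlands/SqrtFiveQuarticCovers`, certificate `CertH12B7` (carrier `Z = X(H12,b7)`, sheets
# 4.1 + 4.3): the named model identification NF-K1-Z (`hK1`) WEAKENED — its side conditions
# `t² + t − 1 ≠ 0`, `u ≠ 0` are consequences of the two `j`-equations, proved here in the kernel

Cell `pub/lg-quartmod` (F-L1), engine seat eng-4 g3; sibling of typ-2's
`Theorems/SqrtFiveQuarticCoversCertH12B7.lean` (p669865, UNTOUCHED and imported) and twin of
`Theorems/SqrtFiveQuarticCoversCertS3H12WeakNF.lean` (same move for the carrier `X(s3,H12)`).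
In `hK1` the fourth disjunct reads `∃ r, r² = 5 ∧ ∃ t u w, t²+t−1 ≠ 0 ∧ u ≠ 0 ∧
c₄³(t²+t−1)⁵ = 125(t+1)(2t+1)³(2t²−3t+3)³Δ ∧ c₄³·u = (u²+13u+49)(u²+5u+1)³Δ ∧ w² = (5+2r)(8t²−12t+7)`
(Zywina's `J₇` on `X(ns⁺5)`, the `X₀(7)` hauptmodul `j₇(u) = (u²+13u+49)(u²+5u+1)³/u`, the cell's
`H12`-conic).  With `Δ ≠ 0` the two non-vanishing clauses are automatic: `u = 0` gives
`0 = 49·Δ`; `t² + t − 1 = 0` makes a factor of the `J₇`-numerator vanish, impossible in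
characteristic `0` (`t = −1 ↦ −1`, `t = −1/2 ↦ −5/4`, `2t²−3t+3 = 0 = t²+t−1 ⇒ t = 1 ↦ 1`) — cusps
have `j = ∞`.  So NF-K1-Z may be ASKED without them: `hK1w` below is `hK1` with exactly the line
`t ^ 2 + t - 1 ≠ 0 ∧ u ≠ 0 ∧` deleted (every other character identical; `hZ` byte-identical to
typ-2's), hence WEAKER, and `certH12B7_of_modelIdentificationWeak_of_theoremZ (hK1w) (hZ) : CertH12B7`
BY NAME.  Offered to the planner seat as the text «ModelIdentificationH12B7w» (registering is not
this seat's call).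

HONEST STATUS: conditional bookkeeping exactly as the parent file — two named inputs (NF-K1-Z in the
weaker form; THEOREM Z, certified finite datum: lineages README-E7.md acceefaa15e0bd61 + E7-TWIN.md
0f3708606b8d5e74 + eng-8 E7-P7-TWIN, certnum RQ-029) ⟹ `CertH12B7`; closes nothing on the ledger by
itself; «a certified finite datum is not a modularity statement»; nothing here proves modularity of
any elliptic curve.  References: as in the parent file ([Zywina2015] Thm. 1.4; [Box2022] §1.1).
-/

noncomputable section

set_option linter.dupNamespace false -- project-wide option; `Summit.Langlands.Langlands` is the mandated namespace

open scoped Matrix NumberField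
open NumberField
open Literature.NumberTheory.Automorphic Summit.Langlands.Langlands.Theses.SqrtFiveQuarticCovers

namespace Summit.Langlands.Langlands.Theorems.SqrtFiveQuarticCovers

/-! ### §1 The side conditions follow from the `j`-equations of `Z` -/

/-- **`t² + t − 1 ≠ 0` is forced by the `J₇`-equation.**  In a field of characteristic `0`, if
`Δ ≠ 0` and `c·(t²+t−1)⁵ = 125(t+1)(2t+1)³(2t²−3t+3)³·Δ` then `t² + t − 1 ≠ 0`: otherwise a factor
of Zywina's `J₇`-numerator vanishes at a root of `t² + t − 1`, forcing `−1 = 0`, `−5/4 = 0` or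
`1 = 0`.  (`t² + t − 1 = 0` are the two cusps of `X(ns⁺5)`.)  Same algebra as
`nfK1_sideConditions_of_jEquations` of the `X(s3,H12)` twin, stated for `J₇` alone. [folklore] -/
theorem t_sq_add_t_sub_one_ne_zero_of_J7_eq {K : Type*} [Field K] [CharZero K] {c Δ t : K}
    (hΔ : Δ ≠ 0) (hJ7 : c * (t ^ 2 + t - 1) ^ 5 =
      125 * (t + 1) * (2 * t + 1) ^ 3 * (2 * t ^ 2 - 3 * t + 3) ^ 3 * Δ) :
    t ^ 2 + t - 1 ≠ 0 := by
  intro hD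
  have h : (125 : K) * ((t + 1) * (2 * t + 1) ^ 3 * (2 * t ^ 2 - 3 * t + 3) ^ 3) * Δ = 0 := by
    have := hJ7
    rw [hD] at this
    linear_combination -this
  rcases mul_eq_zero.mp h with h | h
  · rcases mul_eq_zero.mp h with h | h
    · norm_num at h
    · rcases mul_eq_zero.mp h with h | h
      · rcases mul_eq_zero.mp h with h | h
        · have ht : t = -1 := by linear_combination h
          rw [ht] at hD; norm_num at hD
        · have h' : 2 * t + 1 = 0 := (pow_eq_zero_iff three_ne_zero).mp h
          have ht : t = -1 / 2 := by linear_combination h' / 2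
          rw [ht] at hD; norm_num at hD
      · have h' : 2 * t ^ 2 - 3 * t + 3 = 0 := (pow_eq_zero_iff three_ne_zero).mp h
        have ht : t = 1 := by linear_combination (2 * hD - h') / 5
        rw [ht] at hD; norm_num at hD
  · exact hΔ h

/-- **`u ≠ 0` is forced by the `j₇`-equation of `X₀(7)`.**  If `Δ ≠ 0` and
`c·u = (u²+13u+49)(u²+5u+1)³·Δ` then `u ≠ 0` (else `0 = 49·Δ`; `u = 0` is a cusp of `X₀(7)`).
[folklore] -/
theorem u_ne_zero_of_j7X07_eq {K : Type*} [Field K] [CharZero K] {c Δ u : K} (hΔ : Δ ≠ 0)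
    (hJu : c * u = (u ^ 2 + 13 * u + 49) * (u ^ 2 + 5 * u + 1) ^ 3 * Δ) : u ≠ 0 := by
  rintro rfl
  have h : (49 : K) * Δ = 0 := by linear_combination -hJu
  rcases mul_eq_zero.mp h with h | h
  · norm_num at h
  · exact hΔ h

/-! ### §2 `CertH12B7` from the WEAKER model identification -/

/-- **`CertH12B7` from NF-K1-Z WITHOUT its side conditions and THEOREM Z.**  `hK1w` is the
hypothesis `hK1` of typ-2's `certH12B7` (p669865) with exactly the conjuncts `t ^ 2 + t - 1 ≠ 0 ∧ u ≠ 0 ∧`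
removed from its fourth disjunct — so it only says: `j ∈ {0, 1728, 8000}` or a triple `t, u, w ∈ K`
satisfies the two division-free `j`-equations [Zywina2015 Thm. 1.4: `J₇`; the classical `X₀(7)`
hauptmodul; moduli interpretation] and the cell's `H12`-conic `w² = (5+2r)(8t²−12t+7)` for some
`r² = 5`.  `hZ` is byte-identical to the parent's.  Proof: `t_sq_add_t_sub_one_ne_zero_of_J7_eq` and
`u_ne_zero_of_j7X07_eq` restore the two clauses (with `Δ(E ⊗ K) ≠ 0`), then the parent theorem applies.
CONDITIONAL bookkeeping; a certified finite datum is not a modularity statement.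
[cite: Zywina2015, Thm. 1.4] [cite: Box2022, §1.1 and Thm. 7.1] -/
theorem certH12B7_of_modelIdentificationWeak_of_theoremZ
    (hK1w : ∀ (K : Type) [Field K] [NumberField K], (∃ r : K, r ^ 2 = 5) →
        ∀ E : WeierstrassCurve (NumberField.RingOfIntegers K), E.Δ ≠ 0 →
          (∃ ρ : Literature.NumberTheory.GaloisRepresentations.FramedGaloisRep K (ZMod 5) 2, (∃ e : (E.baseChange K).geomTorsion ((5 : ℕ) : ℤ) ≃+ (Fin 2 → ZMod 5), ∀ (σ : Field.absoluteGaloisGroup K) (P : (E.baseChange K).geomTorsion ((5 : ℕ) : ℤ)), e (σ • P) = ((ρ σ : GL (Fin 2) (ZMod 5)) : Matrix (Fin 2) (Fin 2) (ZMod 5)) *ᵥ (e P)) ∧ ((∀ σ : Field.absoluteGaloisGroup K, (ρ σ : GL (Fin 2) (ZMod 5)) ∈ Subgroup.closure ({(⟨!![3, 1; 3, 3], !![3, 4; 2, 3], by decide, by decide⟩ : GL (Fin 2) (ZMod 5)), (⟨!![1, 0; 0, 4], !![1, 0; 0, 4], by decide, by decide⟩ : GL (Fin 2) (ZMod 5))}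 : Set (GL (Fin 2) (ZMod 5)))))) →
          (∃ ρ : Literature.NumberTheory.GaloisRepresentations.FramedGaloisRep K (ZMod 7) 2, (∃ e : (E.baseChange K).geomTorsion ((7 : ℕ) : ℤ) ≃+ (Fin 2 → ZMod 7), ∀ (σ : Field.absoluteGaloisGroup K) (P : (E.baseChange K).geomTorsion ((7 : ℕ) : ℤ)), e (σ • P) = ((ρ σ : GL (Fin 2) (ZMod 7)) : Matrix (Fin 2) (Fin 2) (ZMod 7)) *ᵥ (e P)) ∧ ((∀ σ : Field.absoluteGaloisGroup K, (((ρ σ : GL (Fin 2) (ZMod 7)) : Matrix (Fin 2) (Fin 2) (ZMod 7)) 1 0 = 0)))) →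
          ((E.baseChange K).c₄ ^ 3 = 0 * (E.baseChange K).Δ ∨
           (E.baseChange K).c₄ ^ 3 = 1728 * (E.baseChange K).Δ ∨
           (E.baseChange K).c₄ ^ 3 = 8000 * (E.baseChange K).Δ ∨
           ∃ r : K, r ^ 2 = 5 ∧ ∃ t u w : K,
            (E.baseChange K).c₄ ^ 3 * (t ^ 2 + t - 1) ^ 5 =
              125 * (t + 1) * (2 * t + 1) ^ 3 * (2 * t ^ 2 - 3 * t + 3) ^ 3 * (E.baseChange K).Δ ∧
            (E.baseChange K).c₄ ^ 3 * u = (u ^ 2 + 13 * u + 49) * (u ^ 2 + 5 * u + 1) ^ 3 * (E.baseChange K).Δ ∧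
            w ^ 2 = (5 + 2 * r) * (8 * t ^ 2 - 12 * t + 7)))
    (hZ : ∀ (K : Type) [Field K] [NumberField K], Module.finrank ℚ K = 4 →
        ∀ r : K, r ^ 2 = 5 → ∀ t u w : K, t ^ 2 + t - 1 ≠ 0 → u ≠ 0 →
          125 * (t + 1) * (2 * t + 1) ^ 3 * (2 * t ^ 2 - 3 * t + 3) ^ 3 * u =
            (u ^ 2 + 13 * u + 49) * (u ^ 2 + 5 * u + 1) ^ 3 * (t ^ 2 + t - 1) ^ 5 →
          w ^ 2 = (5 + 2 * r) * (8 * t ^ 2 - 12 * t + 7) →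
          (u ^ 2 + 13 * u + 49) * (u ^ 2 + 5 * u + 1) ≠ 0 →
          (u ^ 2 + 13 * u + 49) * (u ^ 2 + 5 * u + 1) ^ 3 ≠ 1728 * u →
          (u = -7 ∨ u = 7 ∨ 2 * u ^ 2 + (35 + 5 * r) * u + 98 = 0 ∨ 2 * u ^ 2 + (35 - 5 * r) * u + 98 = 0)) :
    Summit.Langlands.Langlands.Theses.SqrtFiveQuarticCovers.CertH12B7 := by
  refine certH12B7 ?_ hZ
  intro K _ _ hr5 E hΔ h5 h7
  rcases hK1w K hr5 E hΔ h5 h7 with h0 | h1728 | h8000 | ⟨r, hr, t, u, w, hJt, hJu, hw⟩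
  · exact Or.inl h0
  · exact Or.inr (Or.inl h1728)
  · exact Or.inr (Or.inr (Or.inl h8000))
  · have hΔK : (E.baseChange K).Δ ≠ 0 := by
      rw [WeierstrassCurve.baseChange, WeierstrassCurve.map_Δ]
      exact (map_ne_zero_iff _ (FaithfulSMul.algebraMap_injective (𝓞 K) K)).2 hΔ
    exact Or.inr (Or.inr (Or.inr ⟨r, hr, t, u, w, t_sq_add_t_sub_one_ne_zero_of_J7_eq hΔK hJt,
      u_ne_zero_of_j7X07_eq hΔK hJu, hJt, hJu, hw⟩))

end Summit.Langlands.Langlands.Theorems.SqrtFiveQuarticCovers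

end
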